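import Literature.Analysis.FluidPDE.Tao2016AveragedNS.SplitCascadeRescaled
import Literature.Analysis.ODE.LinearComparison
import Mathlib.Analysis.ODE.Gronwall
import HarnessLib

/-!
# The split Prop. 6.5: the asymmetry channels in RESCALED variables (window propagation)

T. Tao, *Finite time blowup for an averaged three-dimensional Navier–Stokes equation*, J. Amer.
Math. Soc. **29** (2016) 601–674 = arXiv:1402.0290v3, §5.5 (5.5) and the proof of Theorem 5.3
(p. 29: the clock `b ≥ 0` during the epoch), §6.4 Prop. 6.5 [`Tao2016AveragedNS`]; Grönwall's
inequality in the form of Mathlib's `le_gronwallBound_of_liminf_deriv_right_le`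
[`HairerNorsettWanner1993`, §I.10].

HONEST FRAMING (cell harvest/h2-tao-ladder, rung 1 of a ladder of MODEL equations): the channel
theorems of `SplitCascadeChannels.lean` (p484343; stated for a solution of the unscaled split system
`SplitODESystem` on a window `[t₁,t₂] ⊆ [0,∞)`) transported VERBATIM to the objects of the split
Prop. 6.5 — the rescaled hypotheses `RescaledSplitHypotheses` of `SplitCascadeRescaled.lean`
(p487601), scale `k`, window `[t₁,t₂] ⊆ [τ_{n₀-N}, ∞)`, source of the rows (6.Z1)–(6.Z3) bounded by
`σ` on the window (in the bootstrap window of the step, `σ = C₁(1+ε₀)^{2k-n₀/2}·sup √F_k` is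
`n₀`-small). Together with the mode equations with explicit asymmetry terms
(`SplitCascadeRescaledModes.lean`) this is the layer through which the tree's §6.5–6.7 bootstrap is
to be re-run for the split system: the asymmetries of the three live scales `k ∈ {-1,0,1}` stay
within `gronwallBound (profile at the checkpoint) (rate) (σ-forcing) (window length ≤ 100)`, i.e.
`n₀`-small, with rates read off the SYMMETRIC amplitudes that the bootstrap controls. By themselves
these lemmas certify nothing about the rung and nothing about Navier–Stokes.

## What is proved (scale `k`, window `[t₁,t₂]`, `t₁ ≥ τ_{n₀-N}`, any `λ > 0`)

* `RescaledSplitHypotheses.asymW_c_sq_le_gronwallBound` — CHANNEL (A): if the clock `b̃_k ≥ -β` on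
  the window, `Z̃_{c,k}(t)² ≤ gronwallBound (Z̃_{c,k}(t₁)²) (2Λ_kε⁻¹K¹⁰β + λ) (σ²/λ) (t - t₁)`,
  `Λ_k = (1+ε₀)^{5k/2}`; `…_of_clock_nonneg`: with `β = 0` no amplification at all.
* `RescaledSplitHypotheses.asymW_ad_sq_le_gronwallBound` — CHANNELS (P)+(H), ROTOR NEUTRAL: with
  pump rate `Λ_k(εb̃_k + ε²e^{-K¹⁰}c̃_k) ≤ M`, hand-off rate `Λ_k(1+ε₀)^{5/2}K ã_{k+1} ≤ M`,
  `|ã_k|, |d̃_k| ≤ R`, `|Z̃_{c,k}| ≤ η_c`: `Z̃_{a,k}² + Z̃_{d,k}² ≤ gronwallBound (…(t₁)) (2M + λ) (2G²/λ) (t - t₁)`,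
  `G = σ + Λ_kε⁻²Rη_c`.
* `RescaledSplitHypotheses.asymW_ad_sq_le_of_clock_nonneg` — the two combined for `b̃_k ≥ 0`.

## References

* T. Tao, J. Amer. Math. Soc. 29 (2016), 601–674 = arXiv:1402.0290v3, Theorem 5.3 proof pp. 29–30,
  §6.4 Prop. 6.5. [`Tao2016AveragedNS`]
* E. Hairer, S. P. Nørsett, G. Wanner, *Solving Ordinary Differential Equations I*, §I.10.
  [`HairerNorsettWanner1993`]
-/

noncomputable section

open Set Metric Filter
open scoped Topology
open Literature.Analysis.ODE

namespace Literature.Analysis.FluidPDE.Tao2016AveragedNS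

open TaoCascade

section Prelim

/-- `2ye ≤ λy² + e²/λ` for `λ > 0`. [folklore] -/
private theorem two_mul_mul_le_of_pos' {lam : ℝ} (hlam : 0 < lam) (y e : ℝ) :
    2 * y * e ≤ lam * y ^ 2 + e ^ 2 / lam := by
  rw [← sub_nonneg]
  have h : lam * y ^ 2 + e ^ 2 / lam - 2 * y * e = (lam * y - e) ^ 2 / lam := by
    field_simp
    ring
  rw [h]
  positivity

end Prelim

section Channels

variable {γ ε₀ K ε C₁ C₂ C₃ : ℝ} {n₀ N : ℤ} {η : ℤ → ℝ} {β : ℕ → ℝ} {τ : ℤ → ℝ}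
  {Y : Fin 4 → ℤ → ℝ → ℝ} {W : Fin 3 → ℤ → ℝ → ℝ} {F : ℤ → ℝ → ℝ}

/-- **Channel (A) in rescaled variables (PROVED): the amplifier asymmetry `Z̃_{c,k}` of a scale is
damped while its clock is non-negative, and only the dissipation-class source accumulates.** Under
the split rescaled hypotheses, fix a scale `k` and a window `[t₁,t₂]`, `t₁ ≥ τ_{n₀-N}`, on which the
clock satisfies `b̃_k ≥ -β₀` and the source of row (6.Z2) satisfies `C₁(1+ε₀)^{2k-n₀/2}√F_k ≤ σ`. Then
for every `λ > 0` and `t ∈ [t₁,t₂]`,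
`Z̃_{c,k}(t)² ≤ gronwallBound (Z̃_{c,k}(t₁)²) (2Λ_kε⁻¹K¹⁰β₀ + λ) (σ²/λ) (t - t₁)`, `Λ_k = (1+ε₀)^{5k/2}`.
[cite: Tao2016AveragedNS, Theorem 5.3 proof p. 29] -/
theorem RescaledSplitHypotheses.asymW_c_sq_le_gronwallBound
    (h : RescaledSplitHypotheses γ ε₀ K ε C₁ C₂ C₃ n₀ N η β τ Y W F)
    (hε₀ : -1 < ε₀) (hε : 0 < ε) {k : ℤ} {t₁ t₂ β₀ σ lam : ℝ} (ht₁ : τ (n₀ - N) ≤ t₁)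
    (hlam : 0 < lam) (hb : ∀ t ∈ Ico t₁ t₂, -β₀ ≤ Y 1 k t)
    (hσ : ∀ t ∈ Ico t₁ t₂, C₁ * (1 + ε₀) ^ ((2 : ℝ) * k - n₀ / 2) * Real.sqrt (F k t) ≤ σ)
    {t : ℝ} (ht : t ∈ Icc t₁ t₂) :
    W 1 k t ^ 2 ≤ gronwallBound (W 1 k t₁ ^ 2)
      (2 * ((1 + ε₀) ^ ((5 : ℝ) * k / 2) * (ε⁻¹ * K ^ 10)) * β₀ + lam) (σ ^ 2 / lam) (t - t₁) := by
  set Λ : ℝ := (1 + ε₀) ^ ((5 : ℝ) * k / 2) with hΛ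
  have hΛ0 : 0 ≤ Λ := (Real.rpow_pos_of_pos (by linarith) _).le
  set y : ℝ → ℝ := W 1 k with hy
  set y' : ℝ → ℝ := fun s => derivWithin (W 1 k) (Ici (τ (n₀ - N))) s with hy'
  have hder : ∀ s ∈ Ico t₁ t₂, HasDerivWithinAt y (y' s) (Ici s) s := fun s hs =>
    hasDerivWithinAt_Ici_of_contDiffOn (h.contDiffOn_W 1 k) (ht₁.trans hs.1)
  have hyc : ContinuousOn y (Icc t₁ t₂) := continuousOn_Icc_of_contDiffOn (h.contDiffOn_W 1 k) ht₁
  have hf' : ∀ s ∈ Ico t₁ t₂,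
      HasDerivWithinAt (fun r => y r * y r) (y' s * y s + y s * y' s) (Ici s) s :=
    fun s hs => (hder s hs).mul (hder s hs)
  have hmain := le_gronwallBound_of_liminf_deriv_right_le (f := fun r => y r * y r)
    (f' := fun s => y' s * y s + y s * y' s) (a := t₁) (b := t₂) (δ := W 1 k t₁ ^ 2)
    (K := 2 * (Λ * (ε⁻¹ * K ^ 10)) * β₀ + lam) (ε := σ ^ 2 / lam)
    (hyc.mul hyc) (fun s hs r hr => (hf' s hs).liminf_right_slope_le hr) (by simp [hy, sq]) ?_
  · simpa [hy, sq] using hmain t ht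
  intro s hs
  have hs0 : τ (n₀ - N) ≤ s := ht₁.trans hs.1
  have hg : 0 ≤ ε⁻¹ * K ^ 10 := by positivity
  -- decomposition of the velocity: y' = -Λ g b y + e, |e| ≤ σ
  set e : ℝ := y' s - Λ * (-(ε⁻¹ * K ^ 10 * Y 1 k s * y s)) with he
  have hdec : y' s = -(Λ * (ε⁻¹ * K ^ 10) * Y 1 k s * y s) + e := by rw [he]; ring
  have he_abs : |e| ≤ σ := (h.eqZ2 k s hs0).trans (hσ s hs)
  have he_sq : e ^ 2 ≤ σ ^ 2 := by
    have := pow_le_pow_left₀ (abs_nonneg _) he_abs 2; rwa [sq_abs] at this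
  -- damping: -2Λ g b y² ≤ 2Λ g β₀ y²
  have hdamp : -(2 * (Λ * (ε⁻¹ * K ^ 10)) * Y 1 k s * y s ^ 2) ≤
      2 * (Λ * (ε⁻¹ * K ^ 10)) * β₀ * y s ^ 2 := by
    have hb' := hb s hs
    have hy2 : 0 ≤ y s ^ 2 := sq_nonneg _
    have h1 : Λ * (ε⁻¹ * K ^ 10) * (-β₀) * y s ^ 2 ≤ Λ * (ε⁻¹ * K ^ 10) * Y 1 k s * y s ^ 2 :=
      mul_le_mul_of_nonneg_right (mul_le_mul_of_nonneg_left hb' (mul_nonneg hΛ0 hg)) hy2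
    linarith
  -- forcing: 2 y e ≤ λ y² + σ²/λ
  have hforce : 2 * y s * e ≤ lam * y s ^ 2 + σ ^ 2 / lam :=
    (two_mul_mul_le_of_pos' hlam _ _).trans
      (add_le_add le_rfl (div_le_div_of_nonneg_right he_sq hlam.le))
  calc y' s * y s + y s * y' s
      = -(2 * (Λ * (ε⁻¹ * K ^ 10)) * Y 1 k s * y s ^ 2) + 2 * y s * e := by rw [hdec]; ring
    _ ≤ 2 * (Λ * (ε⁻¹ * K ^ 10)) * β₀ * y s ^ 2 + (lam * y s ^ 2 + σ ^ 2 / lam) :=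
        add_le_add hdamp hforce
    _ = (2 * (Λ * (ε⁻¹ * K ^ 10)) * β₀ + lam) * (y s * y s) + σ ^ 2 / lam := by ring

/-- **Tao's regime in rescaled variables**: if the clock `b̃_k ≥ 0` on the window, then for every
`λ > 0`, `Z̃_{c,k}(t)² ≤ gronwallBound (Z̃_{c,k}(t₁)²) λ (σ²/λ) (t - t₁)` — no amplification by
`Λ_kε⁻¹K¹⁰` (the previous shell, `b̃₋₁ ≥ 10⁻⁵ε`, and the active shell once `b̃₀` has turned positive).
[cite: Tao2016AveragedNS, Theorem 5.3 proof p. 29] -/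
theorem RescaledSplitHypotheses.asymW_c_sq_le_of_clock_nonneg
    (h : RescaledSplitHypotheses γ ε₀ K ε C₁ C₂ C₃ n₀ N η β τ Y W F)
    (hε₀ : -1 < ε₀) (hε : 0 < ε) {k : ℤ} {t₁ t₂ σ lam : ℝ} (ht₁ : τ (n₀ - N) ≤ t₁)
    (hlam : 0 < lam) (hb : ∀ t ∈ Ico t₁ t₂, 0 ≤ Y 1 k t)
    (hσ : ∀ t ∈ Ico t₁ t₂, C₁ * (1 + ε₀) ^ ((2 : ℝ) * k - n₀ / 2) * Real.sqrt (F k t) ≤ σ)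
    {t : ℝ} (ht : t ∈ Icc t₁ t₂) :
    W 1 k t ^ 2 ≤ gronwallBound (W 1 k t₁ ^ 2) lam (σ ^ 2 / lam) (t - t₁) := by
  have h' := h.asymW_c_sq_le_gronwallBound hε₀ hε (β₀ := 0) ht₁ hlam
    (fun s hs => by simpa using hb s hs) hσ ht
  simpa using h'

/-- **Channels (P)+(H) in rescaled variables, rotor neutral (PROVED).** Under the split rescaled
hypotheses, fix a scale `k` and a window `[t₁,t₂]`, `t₁ ≥ τ_{n₀-N}`, on which: the pump rate
`Λ_k(εb̃_k + ε²e^{-K¹⁰}c̃_k) ≤ M`, the hand-off rate `Λ_k(1+ε₀)^{5/2}K·ã_{k+1} ≤ M`, the symmetric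
amplitudes `|ã_k|, |d̃_k| ≤ R`, the amplifier asymmetry `|Z̃_{c,k}| ≤ η_c`, and the sources of rows
(6.Z1), (6.Z3) `C₁(1+ε₀)^{2k-n₀/2}√F_k ≤ σ`. Then for every `λ > 0` and `t ∈ [t₁,t₂]`,
`Z̃_{a,k}(t)² + Z̃_{d,k}(t)² ≤ gronwallBound (Z̃_{a,k}(t₁)² + Z̃_{d,k}(t₁)²) (2M + λ) (2G²/λ) (t - t₁)` with
`G = σ + Λ_kε⁻²Rη_c`: the rotor terms `∓Λ_kε⁻²c̃_kZ̃_aZ̃_d` cancel in `∂(Z̃_a² + Z̃_d²)`, so `ε⁻²` is never a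
rate. [cite: Tao2016AveragedNS, Theorem 5.3 proof pp. 29–30] -/
theorem RescaledSplitHypotheses.asymW_ad_sq_le_gronwallBound
    (h : RescaledSplitHypotheses γ ε₀ K ε C₁ C₂ C₃ n₀ N η β τ Y W F)
    (hε₀ : -1 < ε₀) (hε : 0 < ε) {k : ℤ} {t₁ t₂ M R ηc σ lam : ℝ} (ht₁ : τ (n₀ - N) ≤ t₁)
    (hlam : 0 < lam) (hR0 : 0 ≤ R)
    (hM0 : ∀ t ∈ Ico t₁ t₂, (1 + ε₀) ^ ((5 : ℝ) * k / 2) *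
      (ε * Y 1 k t + ε ^ 2 * Real.exp (-K ^ 10) * Y 2 k t) ≤ M)
    (hM2 : ∀ t ∈ Ico t₁ t₂, (1 + ε₀) ^ ((5 : ℝ) * k / 2) *
      ((1 + ε₀) ^ ((5 : ℝ) / 2) * K * Y 0 (k + 1) t) ≤ M)
    (hRa : ∀ t ∈ Ico t₁ t₂, |Y 0 k t| ≤ R) (hRd : ∀ t ∈ Ico t₁ t₂, |Y 3 k t| ≤ R)
    (hc : ∀ t ∈ Ico t₁ t₂, |W 1 k t| ≤ ηc)
    (hσ : ∀ t ∈ Ico t₁ t₂, C₁ * (1 + ε₀) ^ ((2 : ℝ) * k - n₀ / 2) * Real.sqrt (F k t) ≤ σ)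
    {t : ℝ} (ht : t ∈ Icc t₁ t₂) :
    W 0 k t ^ 2 + W 2 k t ^ 2 ≤
      gronwallBound (W 0 k t₁ ^ 2 + W 2 k t₁ ^ 2) (2 * M + lam)
        (2 * (σ + (1 + ε₀) ^ ((5 : ℝ) * k / 2) * (ε ^ 2)⁻¹ * R * ηc) ^ 2 / lam) (t - t₁) := by
  set Λ : ℝ := (1 + ε₀) ^ ((5 : ℝ) * k / 2) with hΛ
  have hΛ0 : 0 ≤ Λ := (Real.rpow_pos_of_pos (by linarith) _).le
  set G : ℝ := σ + Λ * (ε ^ 2)⁻¹ * R * ηc with hG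
  set ya : ℝ → ℝ := W 0 k with hya
  set yd : ℝ → ℝ := W 2 k with hyd
  set ya' : ℝ → ℝ := fun s => derivWithin (W 0 k) (Ici (τ (n₀ - N))) s with hya'
  set yd' : ℝ → ℝ := fun s => derivWithin (W 2 k) (Ici (τ (n₀ - N))) s with hyd'
  have hdera : ∀ s ∈ Ico t₁ t₂, HasDerivWithinAt ya (ya' s) (Ici s) s := fun s hs =>
    hasDerivWithinAt_Ici_of_contDiffOn (h.contDiffOn_W 0 k) (ht₁.trans hs.1)
  have hderd : ∀ s ∈ Ico t₁ t₂, HasDerivWithinAt yd (yd' s) (Ici s) s := fun s hs =>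
    hasDerivWithinAt_Ici_of_contDiffOn (h.contDiffOn_W 2 k) (ht₁.trans hs.1)
  have hyac : ContinuousOn ya (Icc t₁ t₂) := continuousOn_Icc_of_contDiffOn (h.contDiffOn_W 0 k) ht₁
  have hydc : ContinuousOn yd (Icc t₁ t₂) := continuousOn_Icc_of_contDiffOn (h.contDiffOn_W 2 k) ht₁
  have hf' : ∀ s ∈ Ico t₁ t₂, HasDerivWithinAt (fun r => ya r * ya r + yd r * yd r)
      ((ya' s * ya s + ya s * ya' s) + (yd' s * yd s + yd s * yd' s)) (Ici s) s := fun s hs =>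
    ((hdera s hs).mul (hdera s hs)).add ((hderd s hs).mul (hderd s hs))
  have hmain := le_gronwallBound_of_liminf_deriv_right_le
    (f := fun r => ya r * ya r + yd r * yd r)
    (f' := fun s => (ya' s * ya s + ya s * ya' s) + (yd' s * yd s + yd s * yd' s)) (a := t₁) (b := t₂)
    (δ := W 0 k t₁ ^ 2 + W 2 k t₁ ^ 2) (K := 2 * M + lam) (ε := 2 * G ^ 2 / lam)
    ((hyac.mul hyac).add (hydc.mul hydc)) (fun s hs r hr => (hf' s hs).liminf_right_slope_le hr)
    (by simp [hya, hyd, sq]) ?_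
  · simpa [hya, hyd, sq] using hmain t ht
  intro s hs
  have hs0 : τ (n₀ - N) ≤ s := ht₁.trans hs.1
  set ea : ℝ := ya' s - Λ * (ε * Y 1 k s * ya s + ε ^ 2 * Real.exp (-K ^ 10) * Y 2 k s * ya s -
      (ε ^ 2)⁻¹ * Y 2 k s * yd s + (ε ^ 2)⁻¹ * Y 3 k s * W 1 k s) with hea
  set ed : ℝ := yd' s - Λ * ((ε ^ 2)⁻¹ * Y 2 k s * ya s - (ε ^ 2)⁻¹ * Y 0 k s * W 1 k s +
      (1 + ε₀) ^ ((5 : ℝ) / 2) * K * Y 0 (k + 1) s * yd s) with hed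
  have hea_abs : |ea| ≤ σ := (h.eqZ1 k s hs0).trans (hσ s hs)
  have hed_abs : |ed| ≤ σ := (h.eqZ3 k s hs0).trans (hσ s hs)
  have hda : ya' s = ea + Λ * (ε * Y 1 k s * ya s + ε ^ 2 * Real.exp (-K ^ 10) * Y 2 k s * ya s -
      (ε ^ 2)⁻¹ * Y 2 k s * yd s + (ε ^ 2)⁻¹ * Y 3 k s * W 1 k s) := by rw [hea]; ring
  have hdd : yd' s = ed + Λ * ((ε ^ 2)⁻¹ * Y 2 k s * ya s - (ε ^ 2)⁻¹ * Y 0 k s * W 1 k s +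
      (1 + ε₀) ^ ((5 : ℝ) / 2) * K * Y 0 (k + 1) s * yd s) := by rw [hed]; ring
  have hr0 : 0 ≤ (ε ^ 2)⁻¹ := by positivity
  have hYc := hc s hs
  have hηc0 : 0 ≤ ηc := (abs_nonneg _).trans hYc
  have hslip : ∀ {x : ℝ}, |x| ≤ R → |Λ * ((ε ^ 2)⁻¹ * x * W 1 k s)| ≤ Λ * (ε ^ 2)⁻¹ * R * ηc := by
    intro x hx
    rw [abs_mul, abs_of_nonneg hΛ0, abs_mul, abs_mul, abs_of_nonneg hr0, mul_assoc Λ, mul_assoc Λ]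
    exact mul_le_mul_of_nonneg_left (mul_le_mul (mul_le_mul_of_nonneg_left hx hr0) hYc
      (abs_nonneg _) (mul_nonneg hr0 hR0)) hΛ0
  have hga : |ea + Λ * ((ε ^ 2)⁻¹ * Y 3 k s * W 1 k s)| ≤ G :=
    (abs_add_le _ _).trans (add_le_add hea_abs (hslip (hRd s hs)))
  have hgd : |ed - Λ * ((ε ^ 2)⁻¹ * Y 0 k s * W 1 k s)| ≤ G :=
    (abs_sub _ _).trans (add_le_add hed_abs (hslip (hRa s hs)))
  have hga2 : (ea + Λ * ((ε ^ 2)⁻¹ * Y 3 k s * W 1 k s)) ^ 2 ≤ G ^ 2 := by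
    have := pow_le_pow_left₀ (abs_nonneg _) hga 2; rwa [sq_abs] at this
  have hgd2 : (ed - Λ * ((ε ^ 2)⁻¹ * Y 0 k s * W 1 k s)) ^ 2 ≤ G ^ 2 := by
    have := pow_le_pow_left₀ (abs_nonneg _) hgd 2; rwa [sq_abs] at this
  have hrate_a : 2 * (Λ * (ε * Y 1 k s + ε ^ 2 * Real.exp (-K ^ 10) * Y 2 k s)) * ya s ^ 2 ≤
      2 * M * ya s ^ 2 := by
    have := mul_le_mul_of_nonneg_right (hM0 s hs) (sq_nonneg (ya s))
    linarith
  have hrate_d : 2 * (Λ * ((1 + ε₀) ^ ((5 : ℝ) / 2) * K * Y 0 (k + 1) s)) * yd s ^ 2 ≤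
      2 * M * yd s ^ 2 := by
    have := mul_le_mul_of_nonneg_right (hM2 s hs) (sq_nonneg (yd s))
    linarith
  have hfa : 2 * ya s * (ea + Λ * ((ε ^ 2)⁻¹ * Y 3 k s * W 1 k s)) ≤ lam * ya s ^ 2 + G ^ 2 / lam :=
    (two_mul_mul_le_of_pos' hlam _ _).trans
      (add_le_add le_rfl (div_le_div_of_nonneg_right hga2 hlam.le))
  have hfd : 2 * yd s * (ed - Λ * ((ε ^ 2)⁻¹ * Y 0 k s * W 1 k s)) ≤ lam * yd s ^ 2 + G ^ 2 / lam :=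
    (two_mul_mul_le_of_pos' hlam _ _).trans
      (add_le_add le_rfl (div_le_div_of_nonneg_right hgd2 hlam.le))
  calc (ya' s * ya s + ya s * ya' s) + (yd' s * yd s + yd s * yd' s)
      = 2 * (Λ * (ε * Y 1 k s + ε ^ 2 * Real.exp (-K ^ 10) * Y 2 k s)) * ya s ^ 2 +
          2 * (Λ * ((1 + ε₀) ^ ((5 : ℝ) / 2) * K * Y 0 (k + 1) s)) * yd s ^ 2 +
          2 * ya s * (ea + Λ * ((ε ^ 2)⁻¹ * Y 3 k s * W 1 k s)) +
          2 * yd s * (ed - Λ * ((ε ^ 2)⁻¹ * Y 0 k s * W 1 k s)) := by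
        rw [hda, hdd]; ring
    _ ≤ 2 * M * ya s ^ 2 + 2 * M * yd s ^ 2 + (lam * ya s ^ 2 + G ^ 2 / lam) +
          (lam * yd s ^ 2 + G ^ 2 / lam) :=
        add_le_add (add_le_add (add_le_add hrate_a hrate_d) hfa) hfd
    _ = (2 * M + lam) * (ya s * ya s + yd s * yd s) + 2 * G ^ 2 / lam := by ring

/-- **The one-window asymmetry budget of a scale in Tao's regime, assembled in rescaled variables
(PROVED).** Under the hypotheses of `asymW_ad_sq_le_gronwallBound` but with the amplifier asymmetry
bound DERIVED from channel (A) in the regime `b̃_k ≥ 0` —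
`η_c = √(gronwallBound (Z̃_{c,k}(t₁)²) λ (σ²/λ) (t₂ - t₁))` — the block obeys
`Z̃_{a,k}² + Z̃_{d,k}² ≤ gronwallBound (Z̃_{a,k}(t₁)² + Z̃_{d,k}(t₁)²) (2M+λ) (2G²/λ) (t-t₁)`,
`G = σ + Λ_kε⁻²Rη_c`: rates `{λ, 2M}` only, forcings `{σ, Λ_kε⁻²Rη_c}`.
[cite: Tao2016AveragedNS, Theorem 5.3 proof pp. 29–30] -/
theorem RescaledSplitHypotheses.asymW_ad_sq_le_of_clock_nonneg
    (h : RescaledSplitHypotheses γ ε₀ K ε C₁ C₂ C₃ n₀ N η β τ Y W F)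
    (hε₀ : -1 < ε₀) (hε : 0 < ε) {k : ℤ} {t₁ t₂ M R σ lam : ℝ} (ht₁ : τ (n₀ - N) ≤ t₁)
    (hlam : 0 < lam) (hR0 : 0 ≤ R) (hb : ∀ t ∈ Ico t₁ t₂, 0 ≤ Y 1 k t)
    (hM0 : ∀ t ∈ Ico t₁ t₂, (1 + ε₀) ^ ((5 : ℝ) * k / 2) *
      (ε * Y 1 k t + ε ^ 2 * Real.exp (-K ^ 10) * Y 2 k t) ≤ M)
    (hM2 : ∀ t ∈ Ico t₁ t₂, (1 + ε₀) ^ ((5 : ℝ) * k / 2) *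
      ((1 + ε₀) ^ ((5 : ℝ) / 2) * K * Y 0 (k + 1) t) ≤ M)
    (hRa : ∀ t ∈ Ico t₁ t₂, |Y 0 k t| ≤ R) (hRd : ∀ t ∈ Ico t₁ t₂, |Y 3 k t| ≤ R)
    (hσ : ∀ t ∈ Ico t₁ t₂, C₁ * (1 + ε₀) ^ ((2 : ℝ) * k - n₀ / 2) * Real.sqrt (F k t) ≤ σ)
    {t : ℝ} (ht : t ∈ Icc t₁ t₂) :
    W 0 k t ^ 2 + W 2 k t ^ 2 ≤
      gronwallBound (W 0 k t₁ ^ 2 + W 2 k t₁ ^ 2) (2 * M + lam)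
        (2 * (σ + (1 + ε₀) ^ ((5 : ℝ) * k / 2) * (ε ^ 2)⁻¹ * R *
          Real.sqrt (gronwallBound (W 1 k t₁ ^ 2) lam (σ ^ 2 / lam) (t₂ - t₁))) ^ 2 / lam)
        (t - t₁) := by
  refine h.asymW_ad_sq_le_gronwallBound hε₀ hε ht₁ hlam hR0 hM0 hM2 hRa hRd (fun s hs => ?_) hσ ht
  have hσ0 : 0 ≤ σ := le_trans (abs_nonneg _) ((h.eqZ2 k s (ht₁.trans hs.1)).trans (hσ s hs))
  have hsq := h.asymW_c_sq_le_of_clock_nonneg hε₀ hε ht₁ hlam hb hσ (t := s) ⟨hs.1, hs.2.le⟩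
  have hmono := gronwallBound_mono (δ := W 1 k t₁ ^ 2) (K := lam) (ε := σ ^ 2 / lam)
    (sq_nonneg _) (by positivity) hlam.le (by linarith [hs.2] : s - t₁ ≤ t₂ - t₁)
  rw [← Real.sqrt_sq_eq_abs]
  exact Real.sqrt_le_sqrt (hsq.trans hmono)

end Channels

end Literature.Analysis.FluidPDE.Tao2016AveragedNS
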